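import Summits.QuantumFields.YangMills.Theorems.SwapVirialDeficitZeroModeSigmaFourSmallBallScaling
import HarnessLib

/-!
# The FOLLOWER CHART of the joint blow-up (brick J1 of memo-24197-massive-mode-rung): `Haar^ι` as `coneConst^{|ι|}·t^{3|ι|}·Lebesgue` in the
# imaginary-dilated cone model centred at prescribed unit quaternions
# (free-hands support of ⟨stmt-QuantumFields-24197⟩ `SwapVirialDeficit.SwapGluedStiffness`; companion of ✓`BlowUp.smallBall_limit_of_blowUp`)

For a finite index set `ι` (the `6L⁴ − 3` followers of the tree-gauged `2L`-slice ring), CENTRES `p : ι → ℍ` with `‖p i‖ = 1` (the box references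
of ✓`SwapRing.swapCommBox_of_swapRingDeficit`: letters `1`/`C_μ`, glued letters, the seam value `c`) and any measurable `f ≥ 0` on `ι → SU(2)`, for every
scale `t > 0`:

  ★★★ `lintegral_haar_pi_eq_followerChart` :
  `∫⁻ U, f U ∂Haar^ι = ofReal(coneConst^{|ι|} · t^{3|ι|}) · ∫⁻ y, 𝟙{∀ i, ‖D³_t (y i)‖ < 1} · f (i ↦ quatToSU2 (p i · D³_t (y i))) ∂vol^ι`,

`D³_t = dilateIm t` (✓`ZeroModeSigma.dilateIm`: real part kept, imaginary part scaled by `t`, `det = t³` ✓`det_dilateIm`).  Ingredients: Haar = radial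
projection of the cone measure (✓`ToronLog.measurePreserving_quatToSU2`, product form `measurePreserving_pi`), left invariance of the cone measure
under unit quaternions (✓`ZeroModeSigma.map_mul_left_coneMeasure`), §1 `pi_coneMeasure_eq` (`cone^ι = coneConst^{|ι|} · vol^ι|_{B^ι}`, boxes +
`Measure.pi_eq`), §2 `pi_volume_eq_smul_map_dilateImPi` (`vol^ι = t^{3|ι|} · (vol^ι).map D^ι_t`, boxes + ✓`Measure.addHaar_preimage_linearMap`, no
determinant of the product map needed).  At `t = √u` this is the follower factor `u^{(18L⁴−9)/2}` of the exact Jacobian `u^{9L⁴−1}` in the scaling identity (S).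
HONEST LABEL: measure theory on `ℍ^ι`/`SU(2)^ι` (plan-level plumbing); NOT the fixed-`L` sharp law, NOT ⟨24197⟩; the Yang–Mills mass gap is NOT proved;
no summit is proved by a line.  Seat ym-line-fcl-p3 g45 (cell ym-idea-1, free hands; item of record ⟨24085⟩ aside, untouched), `--supports stmt-QuantumFields-24197`.
THEOREMS ONLY (0 `def`, 0 `sorry`), standard axioms; the series' local `ℍ` instances.  References: [folklore].
-/

set_option autoImplicit false

noncomputable section

open MeasureTheory Quaternion Set
open scoped Quaternion ENNReal BigOperators NNReal
open Literature.MathematicalPhysics.QuantumLattice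
open Literature.MathematicalPhysics.QuantumFieldTheory (haarProbability)
open Summit.QuantumFields.YangMills.Theorems.SwapTwistDeficit.ToronLog

attribute [local instance] Literature.Analysis.FluidPDE.Tao2016.quatMeasurableSpace
  Literature.Analysis.FluidPDE.Tao2016.quatBorelSpace
  Literature.MathematicalPhysics.QuantumLattice.secondCountableTopology_su2

namespace Summit.QuantumFields.YangMills.Theorems.SwapVirialDeficit.BlowUp

open Summit.QuantumFields.YangMills.Theorems.SwapVirialDeficit.ZeroModeSigma (dilateIm det_dilateIm continuous_dilateIm map_mul_left_coneMeasure)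

variable {ι : Type*} [Fintype ι]

/-! ## §1 The product cone measure is `coneConst^{|ι|}` times Lebesgue on the product ball -/

/-- ★ **`cone^ι = coneConst^{|ι|} · vol^ι|_{B^ι}`** (`B` = the unit ball of `ℍ`): both sides agree on boxes (`Measure.pi_eq`). [folklore] -/
theorem pi_coneMeasure_eq :
    Measure.pi (fun _ : ι => coneMeasure) =
      (ENNReal.ofReal coneConst ^ Fintype.card ι) •
        (Measure.pi fun _ : ι => (volume : Measure ℍ)).restrict (Set.univ.pi fun _ : ι => Metric.ball (0 : ℍ) 1) := by
  haveI := isProbabilityMeasure_coneMeasure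
  refine Measure.pi_eq fun s hs => ?_
  rw [Measure.smul_apply, Measure.restrict_apply (MeasurableSet.univ_pi hs), ← Set.pi_inter_distrib,
    Measure.pi_pi, smul_eq_mul]
  have hcone : ∀ i, coneMeasure (s i) = ENNReal.ofReal coneConst * volume (s i ∩ Metric.ball (0 : ℍ) 1) := by
    intro i
    rw [coneMeasure, Measure.smul_apply, Measure.restrict_apply (hs i), smul_eq_mul, inv_volume_ball_eq]
  simp only [hcone]
  rw [Finset.prod_mul_distrib, Finset.prod_const, Finset.card_univ]

/-! ## §2 The imaginary dilation on every coordinate: `vol^ι = t^{3|ι|} · (vol^ι).map D^ι_t` -/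

omit [Fintype ι] in
/-- The coordinatewise imaginary dilation `D^ι_t y = (D³_t (y i))_i` is measurable. [folklore] -/
theorem measurable_dilateImPi (t : ℝ) : Measurable fun (y : ι → ℍ) (i : ι) => dilateIm t (y i) :=
  measurable_pi_lambda _ fun i => (continuous_dilateIm t).measurable.comp (measurable_pi_apply i)

/-- One coordinate: `vol(D³_t⁻¹ A) = (t³)⁻¹ · vol(A)` (`det D³_t = t³`). [folklore] -/
theorem volume_preimage_dilateIm {t : ℝ} (ht : 0 < t) (A : Set ℍ) :
    volume (dilateIm t ⁻¹' A) = ENNReal.ofReal ((t ^ 3)⁻¹) * volume A := by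
  have hdet : LinearMap.det (dilateIm t) ≠ 0 := by rw [det_dilateIm]; positivity
  rw [Measure.addHaar_preimage_linearMap (μ := (volume : Measure ℍ)) hdet, det_dilateIm, abs_inv, abs_of_pos (by positivity)]

/-- ★ **`vol^ι = t^{3|ι|} · (vol^ι).map D^ι_t`** for `t > 0`: both sides agree on boxes — no determinant of the product map is needed. [folklore] -/
theorem pi_volume_eq_smul_map_dilateImPi {t : ℝ} (ht : 0 < t) :
    (Measure.pi fun _ : ι => (volume : Measure ℍ)) =
      ENNReal.ofReal (t ^ (3 * Fintype.card ι)) • (Measure.pi fun _ : ι => (volume : Measure ℍ)).map (fun (y : ι → ℍ) (i : ι) => dilateIm t (y i)) := by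
  refine Measure.pi_eq fun s hs => ?_
  rw [Measure.smul_apply, Measure.map_apply (measurable_dilateImPi t) (MeasurableSet.univ_pi hs), smul_eq_mul]
  have hpre : (fun (y : ι → ℍ) (i : ι) => dilateIm t (y i)) ⁻¹' (Set.univ.pi s) = Set.univ.pi fun i => dilateIm t ⁻¹' (s i) := by
    ext y; simp only [Set.mem_preimage, Set.mem_univ_pi]
  rw [hpre, Measure.pi_pi]
  simp only [volume_preimage_dilateIm ht]
  rw [Finset.prod_mul_distrib, Finset.prod_const, Finset.card_univ, ← mul_assoc]
  have h3 : 0 < t ^ 3 := by positivity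
  have hk : ENNReal.ofReal (t ^ (3 * Fintype.card ι)) * ENNReal.ofReal ((t ^ 3)⁻¹) ^ Fintype.card ι = 1 := by
    rw [← ENNReal.ofReal_pow (inv_nonneg.2 h3.le), ← ENNReal.ofReal_mul (by positivity), pow_mul, ← mul_pow,
      mul_inv_cancel₀ h3.ne', one_pow, ENNReal.ofReal_one]
  rw [hk, one_mul]

/-- **Change of variables under `D^ι_t`**: `∫⁻ G dvol^ι = t^{3|ι|} · ∫⁻ G ∘ D^ι_t dvol^ι` for measurable `G ≥ 0` and `t > 0`. [folklore] -/
theorem lintegral_pi_volume_eq_dilateImPi {t : ℝ} (ht : 0 < t) (G : (ι → ℍ) → ℝ≥0∞) (hG : Measurable G) :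
    ∫⁻ v, G v ∂(Measure.pi fun _ : ι => (volume : Measure ℍ)) =
      ENNReal.ofReal (t ^ (3 * Fintype.card ι)) * ∫⁻ y, G (fun i => dilateIm t (y i)) ∂(Measure.pi fun _ : ι => (volume : Measure ℍ)) := by
  conv_lhs => rw [pi_volume_eq_smul_map_dilateImPi (ι := ι) ht]
  rw [lintegral_smul_measure, lintegral_map hG (measurable_dilateImPi t), smul_eq_mul]

/-! ## §3 Haar on `SU(2)^ι` through the cone model, centred at prescribed unit quaternions -/

/-- Letter-wise radial projection `ℍ^ι → SU(2)^ι` maps the product cone measure to product Haar measure (✓`measurePreserving_quatToSU2`). [folklore] -/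
theorem measurePreserving_proj_pi :
    MeasurePreserving (fun (v : ι → ℍ) (i : ι) => quatToSU2 (v i)) (Measure.pi fun _ : ι => coneMeasure)
      (Measure.pi fun _ : ι => haarProbability (Matrix.specialUnitaryGroup (Fin 2) ℂ)) := by
  haveI := isProbabilityMeasure_coneMeasure
  exact measurePreserving_pi (fun _ : ι => coneMeasure) (fun _ : ι => haarProbability (Matrix.specialUnitaryGroup (Fin 2) ℂ))
    fun _ => measurePreserving_quatToSU2

/-- Letter-wise left multiplication by unit quaternions preserves the product cone measure (✓`map_mul_left_coneMeasure`). [folklore] -/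
theorem measurePreserving_mul_left_pi (p : ι → ℍ) (hp : ∀ i, ‖p i‖ = 1) :
    MeasurePreserving (fun (v : ι → ℍ) (i : ι) => p i * v i) (Measure.pi fun _ : ι => coneMeasure) (Measure.pi fun _ : ι => coneMeasure) := by
  haveI := isProbabilityMeasure_coneMeasure
  exact measurePreserving_pi (fun _ : ι => coneMeasure) (fun _ : ι => coneMeasure)
    fun i => ⟨(continuous_const.mul continuous_id).measurable, map_mul_left_coneMeasure (hp i)⟩

/-- ★★ **Haar^ι as an average over the product ball, centred at `p`**: for unit quaternions `p i` and measurable `f ≥ 0`,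
`∫⁻ f dHaar^ι = coneConst^{|ι|} · ∫⁻_{B^ι} f (i ↦ quatToSU2 (p i · v i)) dvol^ι`. [folklore] -/
theorem lintegral_haar_pi_eq_ball (p : ι → ℍ) (hp : ∀ i, ‖p i‖ = 1)
    (f : (ι → Matrix.specialUnitaryGroup (Fin 2) ℂ) → ℝ≥0∞) (hf : Measurable f) :
    ∫⁻ U, f U ∂(Measure.pi fun _ : ι => haarProbability (Matrix.specialUnitaryGroup (Fin 2) ℂ)) =
      ENNReal.ofReal coneConst ^ Fintype.card ι *
        ∫⁻ v in Set.univ.pi (fun _ : ι => Metric.ball (0 : ℍ) 1), f (fun i => quatToSU2 (p i * v i))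
          ∂(Measure.pi fun _ : ι => (volume : Measure ℍ)) := by
  have hproj : Measurable fun (v : ι → ℍ) (i : ι) => quatToSU2 (v i) :=
    measurable_pi_lambda _ fun i => measurable_quatToSU2.comp (measurable_pi_apply i)
  have hmul : Measurable fun (v : ι → ℍ) (i : ι) => p i * v i :=
    measurable_pi_lambda _ fun i => (continuous_const.mul continuous_id).measurable.comp (measurable_pi_apply i)
  have h1 := (measurePreserving_proj_pi (ι := ι)).lintegral_comp hf
  have h2 := (measurePreserving_mul_left_pi p hp).lintegral_comp (hf.comp hproj)
  simp only [Function.comp_def] at h1 h2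
  rw [← h1, ← h2, pi_coneMeasure_eq, lintegral_smul_measure, smul_eq_mul]

/-- ★★★ **THE FOLLOWER CHART**: for unit-quaternion centres `p i`, measurable `f ≥ 0` on `SU(2)^ι` and a scale `t > 0`,
`∫⁻ f dHaar^ι = ofReal(coneConst^{|ι|}·t^{3|ι|}) · ∫⁻ y, 𝟙{∀ i, ‖D³_t (y i)‖ < 1} · f (i ↦ quatToSU2 (p i · D³_t (y i))) dvol^ι` —
the follower factor of the exact Jacobian of the joint blow-up (brick J1). [folklore] -/
theorem lintegral_haar_pi_eq_followerChart (p : ι → ℍ) (hp : ∀ i, ‖p i‖ = 1)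
    (f : (ι → Matrix.specialUnitaryGroup (Fin 2) ℂ) → ℝ≥0∞) (hf : Measurable f) {t : ℝ} (ht : 0 < t) :
    ∫⁻ U, f U ∂(Measure.pi fun _ : ι => haarProbability (Matrix.specialUnitaryGroup (Fin 2) ℂ)) =
      ENNReal.ofReal (coneConst ^ Fintype.card ι * t ^ (3 * Fintype.card ι)) *
        ∫⁻ y, {y : ι → ℍ | ∀ i, ‖dilateIm t (y i)‖ < 1}.indicator
            (fun y => f (fun i => quatToSU2 (p i * dilateIm t (y i)))) y ∂(Measure.pi fun _ : ι => (volume : Measure ℍ)) := by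
  have hproj : Measurable fun (v : ι → ℍ) (i : ι) => quatToSU2 (p i * v i) :=
    measurable_pi_lambda _ fun i => measurable_quatToSU2.comp ((continuous_const.mul continuous_id).measurable.comp (measurable_pi_apply i))
  have hB : MeasurableSet (Set.univ.pi fun _ : ι => Metric.ball (0 : ℍ) 1) := MeasurableSet.univ_pi fun _ => measurableSet_ball
  set G : (ι → ℍ) → ℝ≥0∞ := (Set.univ.pi fun _ : ι => Metric.ball (0 : ℍ) 1).indicator fun v => f (fun i => quatToSU2 (p i * v i)) with hGdef
  have hG : Measurable G := (hf.comp hproj).indicator hB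
  rw [lintegral_haar_pi_eq_ball p hp f hf, ← lintegral_indicator hB, lintegral_pi_volume_eq_dilateImPi ht G hG, ← mul_assoc]
  have hc0 : 0 ≤ coneConst := by rw [coneConst]; exact ENNReal.toReal_nonneg
  have hconst : ENNReal.ofReal coneConst ^ Fintype.card ι * ENNReal.ofReal (t ^ (3 * Fintype.card ι)) =
      ENNReal.ofReal (coneConst ^ Fintype.card ι * t ^ (3 * Fintype.card ι)) := by
    rw [← ENNReal.ofReal_pow hc0, ← ENNReal.ofReal_mul (by positivity)]
  rw [hconst]
  congr 1
  refine lintegral_congr fun y => ?_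
  have hmem : (fun i => dilateIm t (y i)) ∈ Set.univ.pi (fun _ : ι => Metric.ball (0 : ℍ) 1) ↔ y ∈ {y : ι → ℍ | ∀ i, ‖dilateIm t (y i)‖ < 1} := by
    simp only [Set.mem_univ_pi, Metric.mem_ball, dist_zero_right, Set.mem_setOf_eq]
  by_cases hy : y ∈ {y : ι → ℍ | ∀ i, ‖dilateIm t (y i)‖ < 1}
  · rw [hGdef, Set.indicator_of_mem (hmem.2 hy), Set.indicator_of_mem hy]
  · rw [hGdef, Set.indicator_of_notMem (fun h => hy (hmem.1 h)), Set.indicator_of_notMem hy]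

end Summit.QuantumFields.YangMills.Theorems.SwapVirialDeficit.BlowUp

end
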